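import Mathlib

/-!
# R90 · S6 (Rogawski Ch. 14.1–5, stable trace formula) — W1-b: fiberwise regrouping

Helper for the S6 socket `R90.S6.sock_S6_langlandsDichotomy : LanglandsDichotomy`
(`Cruxes/H413/Lines/R90_S6_StableTFSpectralB.lean`), wave 1 target W1-b of the S6 target sheet.

If `c : ι → ℂ` is absolutely summable and the sum of `c` over every fibre of `z : ι → X`
vanishes, then the discrete functional `g ↦ ∑' j, c j * g (z j)` vanishes on every bounded
test function `g : X → ℂ`.  Proof: the family `j ↦ c j * g (z j)` is absolutely summable, so it
may be regrouped along the fibres of `z` (`Equiv.sigmaFiberEquiv z`, `HasSum.sigma`); on the fibre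
over `x` it sums to `(∑' fibre, c j) * g x = 0`.

Cell `hodgecm-mathlib`, crux H413 (`stmt-HodgeConjecture-24833`), route of record `HCCMUnconditional`;
programme R90-TF (brief `director/R90-BRIEF.v2.md`), section S6 (base `R90-C14`), seat R90-C14-p02 (g0),
EMIT S6 WAVE 1 (sheet `S6_wave1_targets.v1`, W1-b, signature verbatim).  Lane
`--supports stmt-HodgeConjecture-24833 --as helper`; ONE theorem, pure Mathlib, no definition, no `sorry`.
In Rogawski's argument this is the elementary step of [Rogawski1990, §14.5 p. 241] / [Langlands 1980,
p. 211] («a discrete measure equal to a continuous one is zero»): once the point masses of the discrete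
side of the comparison have been shown to cancel fibrewise, the discrete side vanishes identically.
HONEST LABEL: this file proves no printed global statement; HC_CM is proved only modulo the 7 printed
citations (2 remaining named inputs: hLiu418 = stmt-HodgeConjecture-24832, h413 = stmt-HodgeConjecture-24833)
until rung 0 closes.
-/

set_option autoImplicit false
-- the mandated namespace repeats the single-problem summit's segment (`HodgeConjecture.HodgeConjecture`)
set_option linter.dupNamespace false

namespace Summit.HodgeConjecture.HodgeConjecture.R90.S6

/-- **Fiberwise regrouping (S6 wave 1, W1-b).** If the weights `c` are absolutely summable and every
fibre sum `∑' j : {j // z j = x}, c j` vanishes, then `∑' j, c j * g (z j) = 0` for every bounded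
`g : X → ℂ`. -/
theorem tsum_mul_apply_eq_zero_of_fiberWeights {X : Type*} {ι : Type*} (z : ι → X) {c : ι → ℂ}
    (hc : Summable fun j => ‖c j‖) (h0 : ∀ x : X, ∑' j : {j : ι // z j = x}, c j = 0)
    (g : X → ℂ) (hg : ∃ C : ℝ, ∀ x, ‖g x‖ ≤ C) :
    ∑' j, c j * g (z j) = 0 := by
  obtain ⟨C, hC⟩ := hg
  -- the family `j ↦ c j * g (z j)` is (absolutely) summable
  have hsum : Summable fun j => c j * g (z j) := by
    refine Summable.of_norm_bounded (g := fun j => ‖c j‖ * C) (hc.mul_right C) ?_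
    intro j
    rw [norm_mul]
    exact mul_le_mul_of_nonneg_left (hC (z j)) (norm_nonneg _)
  -- pull the family back along the fibre decomposition `(Σ x, {j // z j = x}) ≃ ι`
  have hsig : HasSum ((fun j => c j * g (z j)) ∘ Equiv.sigmaFiberEquiv z)
      (∑' j, c j * g (z j)) :=
    (Equiv.sigmaFiberEquiv z).hasSum_iff.mpr hsum.hasSum
  -- every fibre sums to `(∑' fibre, c j) * g x = 0`
  have hfib : ∀ x : X,
      HasSum (fun j : {j : ι // z j = x} =>
        ((fun j => c j * g (z j)) ∘ Equiv.sigmaFiberEquiv z) ⟨x, j⟩) 0 := by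
    intro x
    have hcx : Summable fun j : {j : ι // z j = x} => c j :=
      hc.of_norm.subtype fun j => z j = x
    have h1 : HasSum (fun j : {j : ι // z j = x} => c j * g x) 0 := by
      have h2 := hcx.hasSum.mul_right (g x)
      rwa [h0 x, zero_mul] at h2
    have hfun : (fun j : {j : ι // z j = x} =>
        ((fun j => c j * g (z j)) ∘ Equiv.sigmaFiberEquiv z) ⟨x, j⟩) =
        fun j : {j : ι // z j = x} => c j * g x := by
      funext j
      simp only [Function.comp_apply, Equiv.sigmaFiberEquiv_apply, j.2]
    rw [hfun]
    exact h1
  -- regroup: the total sum equals the sum of the fibre sums, i.e. `∑' x, 0 = 0`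
  have htot : HasSum (fun _ : X => (0 : ℂ)) (∑' j, c j * g (z j)) := hsig.sigma hfib
  exact htot.unique hasSum_zero

end Summit.HodgeConjecture.HodgeConjecture.R90.S6
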